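import Literature.NumberTheory.EllipticCurves.Isogeny
import HarnessLib

/-!
# Smith's case split for elliptic curves over `ℚ` (arXiv:2503.17619, Def. 1.6): balanced
# isogenies and Cases I–V

Topic `NumberTheory/EllipticCurves`. Definitions (no theorems of substance, no named facts) for
the top layer of the proof of A. Smith, *The Birch and Swinnerton-Dyer conjecture implies
Goldfeld's conjecture*, arXiv:2503.17619 (2025), Thm. 1.1 (tree: bsd.S34,
`Literature.NumberTheory.EllipticCurves.smith_selmerCorank_density`), §1.1, Def. 1.6:

> *A degree `2` `ℚ`-isogeny `φ : E → E_0` of elliptic curves will be called a balanced isogeny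
> if it satisfies `ℚ(E[2]) = ℚ(E_0[2])`. Here, `ℚ(E[2])` denotes the minimal extension of `ℚ`
> over which every point in `E[2]` is rational. With this defined, it will be convenient to split
> the elliptic curves `E/ℚ` into five cases as follows:*
> *Case I: Either `E(ℚ)[2] = 0`, or `E(ℚ)[2] ≅ (ℤ/2ℤ)²` and `E` has no balanced isogeny.*
> *Case II: `E(ℚ)[2] ≅ ℤ/2ℤ` and, taking `φ : E → E_0` to be the unique degree `2` `ℚ`-isogeny,
> `φ` is not balanced and `E_0(ℚ)[2]` is not `(ℤ/2ℤ)²`.*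
> *Case III: `E(ℚ)[2] ≅ ℤ/2ℤ` and, taking `φ : E → E_0` to be the unique degree `2`
> `ℚ`-isogeny, `E_0(ℚ)[2] ≅ (ℤ/2ℤ)²`.*
> *Case IV: There is a unique balanced isogeny `φ : E → E_0` defined on `E`.*
> *Case V: There are two distinct balanced isogenies defined on `E`.*

Encodings, each an equivalent reading of the printed text on the tree's objects:

* `ℚ(E[2]) = ℚ(E_0[2])` ⟺ `ker ρ̄_{E,2} = ker ρ̄_{E_0,2}` in `Γ_ℚ` (`Isogeny.IsBalanced`): `ℚ(E[2])`
  is the fixed field of the kernel of the mod-`2` representation `ρ̄_{E,2} : Γ_ℚ → Aut(E[2])`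
  (tree: `WeierstrassCurve.galoisRepTorsion W 2`), and two Galois subextensions of `ℚ̄/ℚ`
  coincide iff the corresponding (closed) subgroups of `Γ_ℚ` do (Galois correspondence; the
  kernels are open normal subgroups of finite index).
* `E(ℚ)[2] = 0`, `≅ ℤ/2ℤ`, `≅ (ℤ/2ℤ)²` ⟺ `#E(ℚ)[2] = 1, 2, 4`, where `#E(ℚ)[2]` is computed as the
  number of `Γ_ℚ`-fixed points of `E[2] = E(ℚ̄)[2]` (`ratTwoTorsionCard`): by Galois descent
  (`E(ℚ̄)^{Γ_ℚ} = E(ℚ)`, Silverman VIII.§1; tree `fixedPoints_eq_range_map_holds`) these are the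
  images of the rational `2`-torsion points, and `E(ℚ)[2] ↪ E[2] ≅ (ℤ/2ℤ)²`. (Working inside the
  `Γ_ℚ`-module `E(ℚ̄)` keeps every statement on the objects of the tree's `Isogeny`/`Selmer`
  files.)
* "the unique degree `2` `ℚ`-isogeny" (Cases II, III): when `E(ℚ)[2] ≅ ℤ/2ℤ` every degree-`2`
  `ℚ`-isogeny on `E` has kernel `E(ℚ)[2]` and the quotient is unique up to `ℚ`-isomorphism
  (Silverman, *AEC*, III.4.11–4.12); the definitions quantify existentially over a degree-`2`
  isogeny `φ : E → E_0` in the tree's sense (`WeierstrassCurve.Isogeny`, any model `E_0`), whose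
  existence is the tree theorem `exists_isogeny_ker_eq_and_comp_eq_nsmul_holds`
  (`IsogenyQuotientCurveProofs`), so no case is vacuous.
* "distinct" / "unique" balanced isogenies (Cases IV, V) are counted **by their kernels** (an
  isogeny out of `E` is determined by its kernel up to `ℚ`-isomorphism of the target,
  *AEC* III.4.11): Case IV = some balanced isogeny exists and all balanced isogenies on `E` have
  the same kernel; Case V = two balanced isogenies on `E` with different kernels.
* Codomains `E_0` range over Weierstrass models of *elliptic* curves over `ℚ` (`[W₀.IsElliptic]`),
  as in the source ("isogeny of elliptic curves").

That every elliptic curve over `ℚ` falls into (at least) one of the five cases, the reduction of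
Case III to Cases I, IV, V, and the assembly of Thm. 1.1 from its printed inputs (Cases I–II:
[Smi22a]; Cases IV–V: Thm. 1.17 and [Chil21]; Case III: isogeny invariance) are theorems of the
companion `…Proofs` file.

## References

* [arXiv250317619] A. Smith, arXiv:2503.17619 (2025), §1.1, Def. 1.6 (p. 3).
* [SilvermanAEC2009] J. H. Silverman, *The Arithmetic of Elliptic Curves*, 2nd ed., III.4.11,
  III.4.12, III.§7 (`ℚ(E[m])`, the mod-`m` representation), VIII.§1.
-/

noncomputable section

open scoped Classical
open scoped AddSubgroup

namespace WeierstrassCurve.Isogeny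

variable {W W₀ : WeierstrassCurve ℚ}

/-- **Balanced isogeny** (Smith, arXiv:2503.17619, Def. 1.6): a degree-`2` `ℚ`-isogeny
`φ : E → E_0` with `ℚ(E[2]) = ℚ(E_0[2])`, the latter encoded as the equality
`ker ρ̄_{E,2} = ker ρ̄_{E_0,2}` of the kernels in `Γ_ℚ` of the mod-`2` Galois representations
(`WeierstrassCurve.galoisRepTorsion · 2`), whose fixed fields are `ℚ(E[2])`, `ℚ(E_0[2])`. The
degree is the tree's `Isogeny.degree` (`#ker`, `= deg` in characteristic `0`).
[cite: arXiv250317619, Def. 1.6] -/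
def IsBalanced (φ : Isogeny W W₀) : Prop :=
  φ.degree = 2 ∧ (W.galoisRepTorsion 2).ker = (W₀.galoisRepTorsion 2).ker

/-- Unfolding `IsBalanced`. [cite: arXiv250317619, Def. 1.6] -/
theorem isBalanced_iff (φ : Isogeny W W₀) :
    φ.IsBalanced ↔ φ.degree = 2 ∧ (W.galoisRepTorsion 2).ker = (W₀.galoisRepTorsion 2).ker :=
  Iff.rfl

/-- A balanced isogeny has degree `2`. [cite: arXiv250317619, Def. 1.6] -/
theorem IsBalanced.degree_eq {φ : Isogeny W W₀} (h : φ.IsBalanced) : φ.degree = 2 :=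
  h.1

/-- A balanced isogeny has `ker ρ̄_{E,2} = ker ρ̄_{E_0,2}` (`ℚ(E[2]) = ℚ(E_0[2])`).
[cite: arXiv250317619, Def. 1.6] -/
theorem IsBalanced.ker_eq {φ : Isogeny W W₀} (h : φ.IsBalanced) :
    (W.galoisRepTorsion 2).ker = (W₀.galoisRepTorsion 2).ker :=
  h.2

end WeierstrassCurve.Isogeny

namespace Literature.NumberTheory.EllipticCurves

open WeierstrassCurve

/-- **`#E(ℚ)[2]`**, the number of rational `2`-torsion points of `E = W` (`1`, `2` or `4` for an
elliptic curve), computed as the number of `Γ_ℚ`-fixed points of the `Γ_ℚ`-module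
`E[2] = E(ℚ̄)[2]` (`geomTorsion W 2`); equal to the order of `E(ℚ)[2]` by Galois descent
(Silverman, *AEC*, VIII.§1; tree `fixedPoints_eq_range_map_holds`). Smith, arXiv:2503.17619,
Def. 1.6 (`E(ℚ)[2] = 0`, `≅ ℤ/2ℤ`, `≅ (ℤ/2ℤ)²`). [folklore] -/
def ratTwoTorsionCard (W : WeierstrassCurve ℚ) : ℕ :=
  Nat.card (MulAction.fixedPoints (Field.absoluteGaloisGroup ℚ) (geomTorsion W (2 : ℤ)))

/-- **Case I** of Smith, arXiv:2503.17619, Def. 1.6: *"Either `E(ℚ)[2] = 0`, or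
`E(ℚ)[2] ≅ (ℤ/2ℤ)²` and `E` has no balanced isogeny"* — `#E(ℚ)[2] = 1`, or `#E(ℚ)[2] = 4` and no
`ℚ`-isogeny on `E` (to any model of any curve) is balanced. [cite: arXiv250317619, Def. 1.6] -/
def smithCaseI (W : WeierstrassCurve ℚ) : Prop :=
  ratTwoTorsionCard W = 1 ∨
    (ratTwoTorsionCard W = 4 ∧
      ∀ (W₀ : WeierstrassCurve ℚ) [W₀.IsElliptic] (φ : Isogeny W W₀), ¬ φ.IsBalanced)

/-- **Case II** of Smith, arXiv:2503.17619, Def. 1.6: *"`E(ℚ)[2] ≅ ℤ/2ℤ` and, taking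
`φ : E → E_0` to be the unique degree `2` `ℚ`-isogeny, `φ` is not balanced and `E_0(ℚ)[2]` is
not `(ℤ/2ℤ)²`"* — `#E(ℚ)[2] = 2` and there is a degree-`2` `ℚ`-isogeny `φ : E → E_0` which is
not balanced and with `#E_0(ℚ)[2] ≠ 4` (all degree-`2` isogenies on such an `E` have kernel
`E(ℚ)[2]`, so this does not depend on `φ`). [cite: arXiv250317619, Def. 1.6] -/
def smithCaseII (W : WeierstrassCurve ℚ) : Prop :=
  ratTwoTorsionCard W = 2 ∧
    ∃ (W₀ : WeierstrassCurve ℚ) (_ : W₀.IsElliptic) (φ : Isogeny W W₀), φ.degree = 2 ∧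
      ¬ φ.IsBalanced ∧ ratTwoTorsionCard W₀ ≠ 4

/-- **Case III** of Smith, arXiv:2503.17619, Def. 1.6: *"`E(ℚ)[2] ≅ ℤ/2ℤ` and, taking
`φ : E → E_0` to be the unique degree `2` `ℚ`-isogeny, `E_0(ℚ)[2] ≅ (ℤ/2ℤ)²"* — `#E(ℚ)[2] = 2`
and there is a degree-`2` `ℚ`-isogeny `φ : E → E_0` with `#E_0(ℚ)[2] = 4`.
[cite: arXiv250317619, Def. 1.6] -/
def smithCaseIII (W : WeierstrassCurve ℚ) : Prop :=
  ratTwoTorsionCard W = 2 ∧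
    ∃ (W₀ : WeierstrassCurve ℚ) (_ : W₀.IsElliptic) (φ : Isogeny W W₀), φ.degree = 2 ∧
      ratTwoTorsionCard W₀ = 4

/-- **Case IV** of Smith, arXiv:2503.17619, Def. 1.6: *"There is a unique balanced isogeny
`φ : E → E_0` defined on `E`"* — a balanced isogeny on `E` exists, and any two balanced
isogenies on `E` have the same kernel (uniqueness up to `ℚ`-isomorphism of the target,
Silverman III.4.11). [cite: arXiv250317619, Def. 1.6] -/
def smithCaseIV (W : WeierstrassCurve ℚ) : Prop :=
  (∃ (W₀ : WeierstrassCurve ℚ) (_ : W₀.IsElliptic) (φ : Isogeny W W₀), φ.IsBalanced) ∧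
    ∀ (W₁ W₂ : WeierstrassCurve ℚ) [W₁.IsElliptic] [W₂.IsElliptic] (φ₁ : Isogeny W W₁)
      (φ₂ : Isogeny W W₂),
      φ₁.IsBalanced → φ₂.IsBalanced → φ₁.toAddMonoidHom.ker = φ₂.toAddMonoidHom.ker

/-- **Case V** of Smith, arXiv:2503.17619, Def. 1.6: *"There are two distinct balanced isogenies
defined on `E`"* — two balanced isogenies on `E` with different kernels.
[cite: arXiv250317619, Def. 1.6] -/
def smithCaseV (W : WeierstrassCurve ℚ) : Prop :=
  ∃ (W₁ W₂ : WeierstrassCurve ℚ) (_ : W₁.IsElliptic) (_ : W₂.IsElliptic) (φ₁ : Isogeny W W₁)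
    (φ₂ : Isogeny W W₂),
    φ₁.IsBalanced ∧ φ₂.IsBalanced ∧ φ₁.toAddMonoidHom.ker ≠ φ₂.toAddMonoidHom.ker

/-- Cases IV and V are mutually exclusive (formal). [cite: arXiv250317619, Def. 1.6] -/
theorem not_smithCaseV_of_smithCaseIV {W : WeierstrassCurve ℚ} (h : smithCaseIV W) :
    ¬ smithCaseV W := by
  rintro ⟨W₁, W₂, _, _, φ₁, φ₂, h₁, h₂, hne⟩
  exact hne (h.2 W₁ W₂ φ₁ φ₂ h₁ h₂)

/-- A curve with a balanced isogeny is in Case IV or in Case V (formal: either all balanced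
isogenies share a kernel, or two of them do not). This is the dichotomy behind Smith's Thm. 1.7
("Suppose `E` has a balanced isogeny"). [cite: arXiv250317619, Def. 1.6] -/
theorem smithCaseIV_or_smithCaseV_of_isBalanced {W W₀ : WeierstrassCurve ℚ} [W₀.IsElliptic]
    (φ : Isogeny W W₀) (hφ : φ.IsBalanced) : smithCaseIV W ∨ smithCaseV W := by
  by_cases h : ∀ (W₁ W₂ : WeierstrassCurve ℚ) [W₁.IsElliptic] [W₂.IsElliptic] (φ₁ : Isogeny W W₁)
      (φ₂ : Isogeny W W₂),
      φ₁.IsBalanced → φ₂.IsBalanced → φ₁.toAddMonoidHom.ker = φ₂.toAddMonoidHom.ker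
  · exact Or.inl ⟨⟨W₀, ‹_›, φ, hφ⟩, fun W₁ W₂ _ _ φ₁ φ₂ h₁ h₂ ↦ h W₁ W₂ φ₁ φ₂ h₁ h₂⟩
  · push Not at h
    obtain ⟨W₁, W₂, _, _, φ₁, φ₂, h₁, h₂, hne⟩ := h
    exact Or.inr ⟨W₁, W₂, ‹_›, ‹_›, φ₁, φ₂, h₁, h₂, hne⟩

end Literature.NumberTheory.EllipticCurves

end
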